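import Summits.QuantumFields.BalabanUV.T4Continuum.Support.B13AvgCorrPlaquetteWindow
import Summits.QuantumFields.BalabanUV.T4Continuum.Support.B13AvgCorrStokesLoop
import Summits.QuantumFields.BalabanUV.T4Continuum.Support.B13AvgCorrRefine
import Summits.QuantumFields.BalabanUV.T4Continuum.Support.B13AvgCorrEml
import Summits.QuantumFields.BalabanUV.T4Continuum.Support.SubstrateAvgTowerStructureBelow

/-!
# B13AvgCorrKappa — row NE5, κ-DISCHARGE programme (T4-DAG §8 Q49 (a′); owner design note `HOME/t4/b2b-balaban-t4-ne5-p1/g39/KAPPA-NE5-DESIGN.md`),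
# κ-END: THE ONE-STEP CORRECTION LETTER `hκ` OF THE AVERAGING TOWER OF `expMeanLogSU`, WITH `κ := 3(d∕2 + d²∕8)(2β′ + 2α′²)` UNDER `6(d+2) ≤ L`

Cell `pub-balaban`, unit `b2b-balaban-t4-ne5-formalise-leaf-04` (NE5 formalisation swarm LEAF PROVER 04, gen 19; κ-END assigned to this lineage by the row
owner's RULING R59, `HOME/CLAIMS.log` l.23991, which ADOPTED gen 18's joint-sufficiency probe `…/leaf-04/g18/joint/ProbeKappaEndConcat.lean` 13e4a1fee806d626
as the κ-END of record).  Summits-side NEW WORK under the LEAN PLACEMENT RULE: [folklore] composition of the five κ leaves + real arithmetic; 0 `def`, no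
`Prop`-valued fact minted, nothing printed asserted, no citation tag.

HONEST FRAMING: rung (B)+1 of the FINITE-VOLUME T⁴ programme — NOT infinite volume, NOT a mass gap, NOT the Clay problem, NOT a proof of NE5 (NOT PRINTED;
GAPS G-t4-U3-1).  An estimate on OUR objects (`expMeanLogSU`, `avgTower`, `corr`, `corrAcc`, `holAt`, `loopWord`): it DISCHARGES the substrate's DISPLAYED
one-step letter `hκ` of W-25a (`SubstrateAvgTowerStructure.dist1_corrAcc_le_of_hκ` ∕ `dist1_corrAcc_scaled_le`) and of W-25b's `corr_clause` for
`ℰ = expMeanLogSU` on `SU(N)`, from the two finest-window letters (size `α′`, Lipschitz `β′`) ONLY, under `6(d+2) ≤ L`, with NO smallness condition on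
`α′, β′`.  Nothing of [Balaban1985Averaging] Props 1–4 ∕ [Balaban1987RG1] (0.4)–(0.7) is asserted, reproduced or certified.  HONEST DEPENDENCY (cell line,
verbatim): continuum YM on T⁴ ⇐ BetaPertH ∧ nine spine estimates (0/9 proved); BetaPertH ⇐ (D1) ∧ (D4) ∧ CAP+tail; G-an2-4 gates asym, D1 and NE2/3/4.

THE ROAD (owner design note §2; R59 (1)): strong induction on the V1 step `i` of the averaging tower `U_i = (blockAvg ℰ)^i V`.  At step `i → i+1` the
one-step correction factor `corr ℰ U_i c` is the `expMeanLogSU`-mean of the `(L−1)·L^{d−1}·…` small loop variables `loopHol U_i c r`; κ-L4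
(`B13AvgCorrEml.dist1_corr_le_three_halves_mul`, leaf-06) bounds `dist1` of that mean by `3∕2·` the sup of the loop variables, threshold-free; κ-L3
(`B13AvgCorrRefine.dist1_loopHol_avgTower_le_of_forall`, leaf-02) splits each loop variable of `U_i` into `(d+2)·L` accumulated-correction letters at level `i`
plus the holonomy of `V` along the REFINED loop word at level `0`; κ-L1 (`B13AvgCorrStokesLoop.dist1_holAt_loopWord_le_of_bound`, leaf-01) bounds the latter by
`(L^{i+1}·d·h + (d·h)²∕2)·s` (lattice non-abelian Stokes, `h = L^i·(L−1)∕2` the refined offsets, `s` the finest plaquette letter); `B13AvgCorrPlaquetteWindow`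
(leaf-07, over the owner's κ-L2 `B13AvgCorrPlaquette`) gives `s = (2β′ + 2α′²)∕L^{2K}` from the window letters; the substrate's L-E19 PART 1b
(`SubstrateAvgTowerStructureBelow.kappa_induction`, whose `hstep` hands the accumulated bounds `2κ∕(L^{K−j})²` at all levels `j ≤ i`) closes the induction
once the arithmetic `3∕2·(2(d+2)κ∕L + (d∕2 + d²∕8)(2β′+2α′²)) ≤ κ` holds — which is the case, with equality in the second summand, for
`κ := 3(d∕2 + d²∕8)(2β′ + 2α′²)` as soon as `6(d+2) ≤ L` (§1; sharp at this `κ`).  At `d = 4`: `d∕2 + d²∕8 = 4`, `κ = 12(2β′ + 2α′²)`, `L ≥ 36`.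

WHAT.
* §1 ARITHMETIC (Mathlib reals only): `kappa_end_arith`, `kappa_end_arith_sharp`, `first_term_scale`, `second_term_scale`.
* §2 JUNCTIONS (any `[GaugeGroup G]`): `natAbs_refined_off_le` (`|L^i·off r ν| ≤ L^i·(L−1)∕2` — κ-L1's `hn` binder for κ-L3's refined offsets),
  **`dist1_holAt_refined_loopWord_le`** (κ-L1's END ACCEPTS κ-L3's second summand literally — base `embIter (i+1) c.src`, segment `L^{i+1}`, offsets
  `L^i·off r` — given the finest plaquette letter `s`; ONE application).
* §3 `SU(N)`, ANY unitary `dist1`-realising reading `ι` (`‖ι g − 1‖ = dist1 g`): **`dist1_corr_avgTower_le_local`** (the one-step bound from a LOCAL accumulated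
  budget `a` at level `i` and the window letters: κ-L4 ∘ κ-L3 ∘ §2 ∘ Window — three applications), **`step_arith`** (that bound at `a := 2κ∕(L^{K−i})²` is
  `≤ κ∕(L^{K−1−i})²`), the END **`dist1_corr_avgTower_le`** `: (hι) (hdist) (hL6 : 6·(P.d+2) ≤ P.L) (V) (hβ : 0 ≤ β) (hsize : ∀ b, L^K·dist1 (V b) ≤ α)
  (hlip : ∀ x ν μ, L^K·‖ι (V ⟨x+e_μ, ν⟩) − ι (V ⟨x, ν⟩)‖ ≤ β∕L^K) : ∀ i < P.K, ∀ c, dist1 (corr expMeanLogSU (avgTower expMeanLogSU V i) c) ≤ κ∕((P.L:ℝ)^(P.K−1−i))²`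
  (= PART 1b's `kappa_induction` applied positionally to `dist1_corr_avgTower_le_local` + `step_arith`), its k-INDEXED currency **`dist1_corr_avgTower_scaled_le`**
  (`i + 1 + k = K ⟹ dist1 (corr …)·(lev L k)² ≤ κ` — W-25a `dist1_corrAcc_scaled_le`'s ∕ W-25b `corr_clause`'s binder), the accumulated corollary
  **`dist1_corrAcc_avgTower_le`** (`≤ 2κ∕(L^{K−j})²`, `j ≤ K`; ONE application of W-25a), and the model-reading specialisation
  **`dist1_corr_avgTower_le_fundamentalRep`** (`ι := fundamentalRep n`, `‖U − 1‖ = dist1 U` by `rfl`; the Lipschitz letter on the matrices themselves).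
Independent confirmation of the same END and numbers on the same staged bytes: leaf-08-g18 `…/leaf-08/g18/kappa/ConcatKappaEnd.lean` 8033dfdd2611a84c
(journal l.23874 ∕ l.23884; its §4 proves the k-indexed form first — the two currencies are interderivable by `cast_lev'`).
0 sorry; axioms ⊆ {propext, Classical.choice, Quot.sound}.
-/

noncomputable section

open scoped BigOperators

namespace Summit.QuantumFields.BalabanUV.T4Continuum.B13AvgCorrKappa

/-! ## §1 Arithmetic: the self-consistent `κ` and the `L`-condition of the road -/

section Arith

/-- [folklore] **THE SELF-CONSISTENT CHOICE**: with `κ = 3·c·B` and `6(d+2) ≤ L` (`L > 0`, `κ ≥ 0`), `3∕2·(2(d+2)κ∕L + c·B) ≤ κ`. -/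
theorem kappa_end_arith {d L κ c B : ℝ} (hL0 : 0 < L) (hκ0 : 0 ≤ κ) (hL : 6 * (d + 2) ≤ L) (hκ : κ = 3 * (c * B)) :
    3 / 2 * (2 * (d + 2) * κ / L + c * B) ≤ κ := by
  have h1 : 2 * (d + 2) * κ / L ≤ κ / 3 := by
    rw [div_le_iff₀ hL0]
    nlinarith [mul_le_mul_of_nonneg_left hL hκ0]
  nlinarith [h1]

/-- [folklore] **SHARPNESS OF THE `L`-CONDITION AT `κ = 3cB`**: if `L < 6(d+2)` and `κ > 0` the inequality of `kappa_end_arith` FAILS. -/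
theorem kappa_end_arith_sharp {d L κ c B : ℝ} (hL0 : 0 < L) (hκ0 : 0 < κ) (hL : L < 6 * (d + 2)) (hκ : κ = 3 * (c * B)) :
    ¬ (3 / 2 * (2 * (d + 2) * κ / L + c * B) ≤ κ) := by
  intro h
  have h1 : κ / 3 < 2 * (d + 2) * κ / L := by
    rw [lt_div_iff₀ hL0]
    nlinarith [mul_lt_mul_of_pos_left hL hκ0]
  nlinarith [h1]

/-- [folklore] the first summand in the coarse currency: `(d+2)·L·(2κ∕(L^(K−i))²) = 2(d+2)κ∕(L·(L^(K−1−i))²)` for `i < K`. -/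
theorem first_term_scale {d L κ : ℝ} {i K : ℕ} (hL : 0 < L) (hiK : i < K) :
    (d + 2) * L * (2 * κ / (L ^ (K - i)) ^ 2) = 2 * (d + 2) * κ / (L * (L ^ (K - 1 - i)) ^ 2) := by
  have e : K - i = (K - 1 - i) + 1 := by omega
  rw [e, pow_succ]
  field_simp
  ring

/-- [folklore] the second summand in the coarse currency: with `h ≤ L^i·L∕2` (the refined offsets: `(L−1)∕2 ≤ L∕2`) and `i + 1 ≤ K`,
`(L^(i+1)·d·h + (d·h)²∕2)·(B∕(L^K)²) ≤ (d∕2 + d²∕8)·B∕(L^(K−1−i))²`. -/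
theorem second_term_scale {d L B h : ℝ} {i K : ℕ} (hL : 0 < L) (hd : 0 ≤ d) (hB : 0 ≤ B) (hh0 : 0 ≤ h)
    (hh : h ≤ L ^ i * (L / 2)) (hiK : i + 1 ≤ K) :
    (L ^ (i + 1) * (d * h) + (d * h) ^ 2 / 2) * (B / (L ^ K) ^ 2) ≤ (d / 2 + d ^ 2 / 8) * B / (L ^ (K - 1 - i)) ^ 2 := by
  obtain ⟨m, hm⟩ : ∃ m, K = m + (i + 1) := ⟨K - (i + 1), by omega⟩
  subst hm
  have hKm : m + (i + 1) - 1 - i = m := by omega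
  rw [hKm]
  set X := L ^ (i + 1) with hX
  have hX0 : 0 < X := pow_pos hL _
  have hm0 : 0 < L ^ m := pow_pos hL _
  have epow : L ^ (m + (i + 1)) = L ^ m * X := by rw [pow_add]
  rw [epow]
  have hh' : h ≤ X / 2 := by rw [hX, pow_succ]; nlinarith [hh]
  have hdh : d * h ≤ d * (X / 2) := mul_le_mul_of_nonneg_left hh' hd
  have hdh0 : 0 ≤ d * h := mul_nonneg hd hh0
  have hsq : (d * h) ^ 2 ≤ (d * (X / 2)) ^ 2 := pow_le_pow_left₀ hdh0 hdh 2
  have key : X * (d * h) + (d * h) ^ 2 / 2 ≤ (d / 2 + d ^ 2 / 8) * X ^ 2 := by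
    nlinarith [mul_le_mul_of_nonneg_left hdh hX0.le]
  have e : (X * (d * h) + (d * h) ^ 2 / 2) * (B / (L ^ m * X) ^ 2)
      = ((X * (d * h) + (d * h) ^ 2 / 2) / X ^ 2) * (B / (L ^ m) ^ 2) := by
    field_simp
  rw [e]
  have hfrac : (X * (d * h) + (d * h) ^ 2 / 2) / X ^ 2 ≤ d / 2 + d ^ 2 / 8 := by
    rw [div_le_iff₀ (by positivity)]; exact key
  have hB' : 0 ≤ B / (L ^ m) ^ 2 := by positivity
  calc (X * (d * h) + (d * h) ^ 2 / 2) / X ^ 2 * (B / (L ^ m) ^ 2) ≤ (d / 2 + d ^ 2 / 8) * (B / (L ^ m) ^ 2) :=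
        mul_le_mul_of_nonneg_right hfrac hB'
    _ = (d / 2 + d ^ 2 / 8) * B / (L ^ m) ^ 2 := by ring

/-- [folklore] the numbers at `d = 4`: `c_4 = 4∕2 + 16∕8 = 4` (so `κ = 12·(2β′ + 2α′²)`), `L ≥ 6·(4+2) = 36` (the design note v0.1 had `L ≥ 16(d+2) = 96`). -/
example : (4 : ℝ) / 2 + 4 ^ 2 / 8 = 4 ∧ (3 : ℝ) * 4 = 12 ∧ (6 : ℝ) * (4 + 2) = 36 ∧ (16 : ℝ) * (4 + 2) = 96 := by norm_num

end Arith

open Literature.MathematicalPhysics.QuantumFieldTheory.Balaban1983to89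
open Literature.MathematicalPhysics.QuantumFieldTheory.Balaban1983to89.T4Continuum (walk holAt loopWord)
open Literature.MathematicalPhysics.QuantumFieldTheory.Balaban1983to89.BlockAveraging (Idx off off_bounds loopHol corr)
open Literature.MathematicalPhysics.QuantumFieldTheory.Balaban1983to89.ExpMeanLog (expMeanLogSU)
open Literature.MathematicalPhysics.QuantumFieldTheory.Balaban1983to89.B5G183RateUnitTower (lev)
open Literature.MathematicalPhysics.QuantumLattice (fundamentalRep fundamentalRep_apply fundamentalRep_mem_unitaryGroup)
open Summit.QuantumFields.BalabanUV.T4Continuum.BalabanAveragedTowerUnit (cast_lev' one_le_lev')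
open Summit.QuantumFields.BalabanUV.T4Continuum.SubstrateAvgTowerStructure (avgTower corrAcc dist1_corrAcc_le_of_hκ)

/-! ## §2 Junctions: κ-L1's END accepts κ-L3's refined loop words -/

section Junction

variable {P : Params} {G : Type*} [GaugeGroup G]

/-- [folklore] the refined offsets of κ-L3's END are bounded by `L^i·(L−1)∕2` — κ-L1's `hn` binder. -/
theorem natAbs_refined_off_le (i : ℕ) (r : Fin P.d → Fin P.L) (ν : Fin P.d) :
    (((P.L : ℤ) ^ i) * off r ν).natAbs ≤ P.L ^ i * ((P.L - 1) / 2) := by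
  rw [Int.natAbs_mul, Int.natAbs_pow, Int.natAbs_natCast]
  exact Nat.mul_le_mul_left _ (by have h := off_bounds r ν; omega)

/-- [folklore] **κ-L3 ⟵ κ-L1**: κ-L1's END `B13AvgCorrStokesLoop.dist1_holAt_loopWord_le_of_bound` ACCEPTS κ-L3's second summand LITERALLY (base
`embIter (i+1) c.src` at level `0`, segment `L^(i+1)`, offsets `L^i·off r`), given the finest plaquette letter `s`: the holonomy of `V` along the refined
loop word is within `(L^(i+1)·d·h + (d·h)²∕2)·s` of `1`, `h = L^i·(L−1)∕2`.  ONE application. -/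
theorem dist1_holAt_refined_loopWord_le (V : GaugeField P 0 G) {s : ℝ} (hs0 : 0 ≤ s) (hp : ∀ p : Plaq P 0, dist1 (GaugeField.plaqHol V p) ≤ s)
    (i : ℕ) (c : PBond P (i + 1)) (r : Idx P) :
    dist1 (holAt V (walk (B13AvgCorrRefine.embIter (i + 1) c.src)
        (loopWord (P.L ^ (i + 1)) c.dir (fun ν => ((P.L : ℤ) ^ i) * off r.1 ν) r.2.1 r.2.2)))
      ≤ (((P.L ^ (i + 1) : ℕ) : ℝ) * ((P.d : ℝ) * ((P.L ^ i * ((P.L - 1) / 2) : ℕ) : ℝ))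
          + ((P.d : ℝ) * ((P.L ^ i * ((P.L - 1) / 2) : ℕ) : ℝ)) ^ 2 / 2) * s :=
  B13AvgCorrStokesLoop.dist1_holAt_loopWord_le_of_bound V hs0 (B13AvgCorrStokes.plaq_pair_bound_of_plaqHol V hp)
    (B13AvgCorrRefine.embIter (i + 1) c.src) (P.L ^ (i + 1)) c.dir _ r.2.1 r.2.2 (natAbs_refined_off_le i r.1)

end Junction

/-! ## §3 `SU(N)` with the printed exp-mean-log: the one-step bound and the induction (κ-END) -/

section SU

open scoped Matrix Matrix.Norms.L2Operator

variable {P : Params} {n : Type*} [Fintype n] [DecidableEq n] [Nonempty n] {o : Type*} [Fintype o] [DecidableEq o]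
  (ι : Matrix.specialUnitaryGroup n ℂ →* Matrix o o ℂ)

/-- [folklore] **THE ONE-STEP BOUND FROM A LOCAL ACCUMULATED BUDGET**: for the `SU(N)` exp-mean-log average, any unitary reading `ι` with `‖ι g − 1‖ = dist1 g`,
a finest field `V` with the window letters (size `α`, Lipschitz `β ≥ 0`) and a budget `dist1 (corrAcc ℰ V i b) ≤ a` at level `i`, the one-step correction
factor at the coarse bond `c` of step `i → i+1` is within `3∕2·[(d+2)·L·a + (L^(i+1)·d·h + (d·h)²∕2)·(2β + 2α²)∕L^(2K)]` of `1`, `h = L^i·(L−1)∕2`.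
THREE positional applications: κ-L4 `dist1_corr_le_three_halves_mul` ∘ κ-L3 `dist1_loopHol_avgTower_le_of_forall` ∘ (§2 with Window `dist1_plaqHol_le_of_window`). -/
theorem dist1_corr_avgTower_le_local (hι : ∀ g, ι g ∈ Matrix.unitaryGroup o ℂ) (hdist : ∀ g, ‖ι g - 1‖ = dist1 g)
    (V : GaugeField P 0 (Matrix.specialUnitaryGroup n ℂ)) {α β : ℝ} (hβ : 0 ≤ β)
    (hsize : ∀ b : PBond P 0, (P.L : ℝ) ^ P.K * dist1 (V b) ≤ α)
    (hlip : ∀ (x : Site P 0) (ν μ : Fin P.d), (P.L : ℝ) ^ P.K * ‖ι (V ⟨x.shift μ, ν⟩) - ι (V ⟨x, ν⟩)‖ ≤ β / (P.L : ℝ) ^ P.K)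
    (i : ℕ) (c : PBond P (i + 1)) {a : ℝ} (ha : ∀ b : PBond P i, dist1 (corrAcc (expMeanLogSU (n := n)) V i b) ≤ a) :
    dist1 (corr (expMeanLogSU (n := n)) (avgTower (expMeanLogSU (n := n)) V i) c) ≤
      3 / 2 * (((P.d + 2) * P.L : ℕ) * a
        + (((P.L ^ (i + 1) : ℕ) : ℝ) * ((P.d : ℝ) * ((P.L ^ i * ((P.L - 1) / 2) : ℕ) : ℝ))
            + ((P.d : ℝ) * ((P.L ^ i * ((P.L - 1) / 2) : ℕ) : ℝ)) ^ 2 / 2) * ((2 * β + 2 * α ^ 2) / (P.L : ℝ) ^ (2 * P.K))) :=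
  B13AvgCorrEml.dist1_corr_le_three_halves_mul _ c fun r =>
    (B13AvgCorrRefine.dist1_loopHol_avgTower_le_of_forall (expMeanLogSU (n := n)) V i ha c r).trans
      (add_le_add le_rfl (dist1_holAt_refined_loopWord_le V (by positivity)
        (fun p => B13AvgCorrPlaquetteWindow.dist1_plaqHol_le_of_window ι hι hdist V hsize hlip p) i c r))

/-- [folklore] **THE ARITHMETIC OF ONE STEP** in the chain's cast spelling: with `a := 2κ∕(L^(K−i))²`, `κ := 3(d∕2 + d²∕8)(2β + 2α²)` and `6(d+2) ≤ L`,
the bound of `dist1_corr_avgTower_le_local` is `≤ κ∕(L^(K−1−i))²` (`first_term_scale` + `second_term_scale` + `kappa_end_arith`). -/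
theorem step_arith (hL6 : 6 * (P.d + 2) ≤ P.L) {α β : ℝ} (hβ : 0 ≤ β) {i : ℕ} (hi : i < P.K) :
    let κ : ℝ := 3 * (((P.d : ℝ) / 2 + (P.d : ℝ) ^ 2 / 8) * (2 * β + 2 * α ^ 2))
    3 / 2 * (((P.d + 2) * P.L : ℕ) * (2 * κ / ((P.L : ℝ) ^ (P.K - i)) ^ 2)
        + (((P.L ^ (i + 1) : ℕ) : ℝ) * ((P.d : ℝ) * ((P.L ^ i * ((P.L - 1) / 2) : ℕ) : ℝ))
            + ((P.d : ℝ) * ((P.L ^ i * ((P.L - 1) / 2) : ℕ) : ℝ)) ^ 2 / 2) * ((2 * β + 2 * α ^ 2) / (P.L : ℝ) ^ (2 * P.K)))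
      ≤ κ / ((P.L : ℝ) ^ (P.K - 1 - i)) ^ 2 := by
  intro κ
  have hL0 : (0 : ℝ) < P.L := by exact_mod_cast P.L_pos
  have hd : (0 : ℝ) ≤ P.d := Nat.cast_nonneg _
  have hB : (0 : ℝ) ≤ 2 * β + 2 * α ^ 2 := by positivity
  have hκ0 : 0 ≤ κ := by positivity
  have hL6' : (6 : ℝ) * ((P.d : ℝ) + 2) ≤ P.L := by exact_mod_cast hL6
  have hℓ : (0 : ℝ) < ((P.L : ℝ) ^ (P.K - 1 - i)) ^ 2 := by positivity
  -- first summand in the coarse currency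
  have t1 : (((P.d + 2) * P.L : ℕ) : ℝ) * (2 * κ / ((P.L : ℝ) ^ (P.K - i)) ^ 2)
      = 2 * ((P.d : ℝ) + 2) * κ / ((P.L : ℝ) * ((P.L : ℝ) ^ (P.K - 1 - i)) ^ 2) := by
    rw [show (((P.d + 2) * P.L : ℕ) : ℝ) = ((P.d : ℝ) + 2) * (P.L : ℝ) by push_cast; ring]
    exact first_term_scale hL0 hi
  -- second summand: the refined offsets `h ≤ L^i·L∕2`
  set h : ℝ := ((P.L ^ i * ((P.L - 1) / 2) : ℕ) : ℝ) with hhdef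
  have hh0 : 0 ≤ h := Nat.cast_nonneg _
  have hh : h ≤ (P.L : ℝ) ^ i * ((P.L : ℝ) / 2) := by
    have hhalf : (2 : ℝ) * (((P.L - 1) / 2 : ℕ) : ℝ) ≤ P.L := by
      have : 2 * ((P.L - 1) / 2) ≤ P.L := by omega
      exact_mod_cast this
    rw [hhdef, Nat.cast_mul, Nat.cast_pow]
    exact mul_le_mul_of_nonneg_left (by linarith) (by positivity)
  have t2 : (((P.L ^ (i + 1) : ℕ) : ℝ) * ((P.d : ℝ) * h) + ((P.d : ℝ) * h) ^ 2 / 2) * ((2 * β + 2 * α ^ 2) / (P.L : ℝ) ^ (2 * P.K))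
      ≤ ((P.d : ℝ) / 2 + (P.d : ℝ) ^ 2 / 8) * (2 * β + 2 * α ^ 2) / ((P.L : ℝ) ^ (P.K - 1 - i)) ^ 2 := by
    rw [Nat.cast_pow, pow_mul']
    exact second_term_scale hL0 hd hB hh0 hh (by omega)
  -- assemble: `3∕2·(T1 + T2) ≤ (3∕2·(2(d+2)κ∕L + cB))∕ℓ² ≤ κ∕ℓ²`
  have key := kappa_end_arith (κ := κ) (c := (P.d : ℝ) / 2 + (P.d : ℝ) ^ 2 / 8) (B := 2 * β + 2 * α ^ 2) hL0 hκ0 hL6' (by ring)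
  rw [t1]
  calc 3 / 2 * (2 * ((P.d : ℝ) + 2) * κ / ((P.L : ℝ) * ((P.L : ℝ) ^ (P.K - 1 - i)) ^ 2)
          + (((P.L ^ (i + 1) : ℕ) : ℝ) * ((P.d : ℝ) * h) + ((P.d : ℝ) * h) ^ 2 / 2) * ((2 * β + 2 * α ^ 2) / (P.L : ℝ) ^ (2 * P.K)))
      ≤ 3 / 2 * (2 * ((P.d : ℝ) + 2) * κ / ((P.L : ℝ) * ((P.L : ℝ) ^ (P.K - 1 - i)) ^ 2)
          + ((P.d : ℝ) / 2 + (P.d : ℝ) ^ 2 / 8) * (2 * β + 2 * α ^ 2) / ((P.L : ℝ) ^ (P.K - 1 - i)) ^ 2) := by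
        gcongr
    _ = (3 / 2 * (2 * ((P.d : ℝ) + 2) * κ / P.L + ((P.d : ℝ) / 2 + (P.d : ℝ) ^ 2 / 8) * (2 * β + 2 * α ^ 2)))
          / ((P.L : ℝ) ^ (P.K - 1 - i)) ^ 2 := by
        field_simp
    _ ≤ κ / ((P.L : ℝ) ^ (P.K - 1 - i)) ^ 2 := div_le_div_of_nonneg_right key hℓ.le

/-- [folklore] **κ-END — THE ONE-STEP CORRECTION LETTER `hκ` OF THE AVERAGING TOWER, IN THE DISPLAY SHAPE OF W-25a `dist1_corrAcc_le_of_hκ`.**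
For the printed `SU(N)` exp-mean-log average, ANY unitary reading `ι` with `‖ι g − 1‖ = dist1 g`, ANY finest configuration `V` carrying the two window
letters (size `α`, Lipschitz `β ≥ 0`; NO smallness on `α, β`), and `6(d+2) ≤ L`:
`∀ i < K, ∀ c, dist1 (corr expMeanLogSU (avgTower expMeanLogSU V i) c) ≤ κ∕(L^(K−1−i))²` with `κ := 3(d∕2 + d²∕8)(2β + 2α²)`.
= the substrate's `SubstrateAvgTowerStructureBelow.kappa_induction` (PART 1b; its `hstep` hands ALL levels `j ≤ i`, this step reads level `i` only —
ONE positional application, no adapter) ∘ `dist1_corr_avgTower_le_local` ∘ `step_arith`. -/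
theorem dist1_corr_avgTower_le (hι : ∀ g, ι g ∈ Matrix.unitaryGroup o ℂ) (hdist : ∀ g, ‖ι g - 1‖ = dist1 g)
    (hL6 : 6 * (P.d + 2) ≤ P.L) (V : GaugeField P 0 (Matrix.specialUnitaryGroup n ℂ)) {α β : ℝ} (hβ : 0 ≤ β)
    (hsize : ∀ b : PBond P 0, (P.L : ℝ) ^ P.K * dist1 (V b) ≤ α)
    (hlip : ∀ (x : Site P 0) (ν μ : Fin P.d), (P.L : ℝ) ^ P.K * ‖ι (V ⟨x.shift μ, ν⟩) - ι (V ⟨x, ν⟩)‖ ≤ β / (P.L : ℝ) ^ P.K) :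
    ∀ i < P.K, ∀ c : PBond P (i + 1),
      dist1 (corr (expMeanLogSU (n := n)) (avgTower (expMeanLogSU (n := n)) V i) c)
        ≤ 3 * (((P.d : ℝ) / 2 + (P.d : ℝ) ^ 2 / 8) * (2 * β + 2 * α ^ 2)) / ((P.L : ℝ) ^ (P.K - 1 - i)) ^ 2 := by
  have hL2 : 2 ≤ P.L := by omega
  have hκ0 : (0 : ℝ) ≤ 3 * (((P.d : ℝ) / 2 + (P.d : ℝ) ^ 2 / 8) * (2 * β + 2 * α ^ 2)) := by positivity
  refine SubstrateAvgTowerStructureBelow.kappa_induction (expMeanLogSU (n := n)) hL2 V hκ0 ?_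
  intro i hi hacc c
  exact (dist1_corr_avgTower_le_local ι hι hdist V hβ hsize hlip i c (hacc i le_rfl)).trans (step_arith hL6 hβ hi)

/-- [folklore] **κ-END IN THE k-INDEXED CURRENCY** of W-25a `dist1_corrAcc_scaled_le` ∕ W-25b `corr_clause` (`i + 1 + k = K` names the step by the NE2 level
of its coarse lattice): `dist1 (corr expMeanLogSU (avgTower expMeanLogSU V i) c)·(lev L k)² ≤ κ`, same `κ`, same data. -/
theorem dist1_corr_avgTower_scaled_le (hι : ∀ g, ι g ∈ Matrix.unitaryGroup o ℂ) (hdist : ∀ g, ‖ι g - 1‖ = dist1 g)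
    (hL6 : 6 * (P.d + 2) ≤ P.L) (V : GaugeField P 0 (Matrix.specialUnitaryGroup n ℂ)) {α β : ℝ} (hβ : 0 ≤ β)
    (hsize : ∀ b : PBond P 0, (P.L : ℝ) ^ P.K * dist1 (V b) ≤ α)
    (hlip : ∀ (x : Site P 0) (ν μ : Fin P.d), (P.L : ℝ) ^ P.K * ‖ι (V ⟨x.shift μ, ν⟩) - ι (V ⟨x, ν⟩)‖ ≤ β / (P.L : ℝ) ^ P.K) :
    ∀ (i k : ℕ), i + 1 + k = P.K → ∀ c : PBond P (i + 1),
      dist1 (corr (expMeanLogSU (n := n)) (avgTower (expMeanLogSU (n := n)) V i) c) * ((lev P.L k : ℕ) : ℝ) ^ 2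
        ≤ 3 * (((P.d : ℝ) / 2 + (P.d : ℝ) ^ 2 / 8) * (2 * β + 2 * α ^ 2)) := by
  intro i k hik c
  have h := dist1_corr_avgTower_le ι hι hdist hL6 V hβ hsize hlip i (by omega) c
  have hk : P.K - 1 - i = k := by omega
  have hℓ : (0 : ℝ) < ((lev P.L k : ℕ) : ℝ) ^ 2 := pow_pos (by exact_mod_cast one_le_lev' P.L k) 2
  rw [hk, ← cast_lev' P.L k, le_div_iff₀ hℓ] at h
  exact h

/-- [folklore] … hence the substrate's ACCUMULATED-CORRECTION bound (W-25a `dist1_corrAcc_le_of_hκ`) with that `κ`: for `j ≤ K`,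
`dist1 (corrAcc expMeanLogSU V j c) ≤ 2κ∕(L^(K−j))²`.  ONE more application. -/
theorem dist1_corrAcc_avgTower_le (hι : ∀ g, ι g ∈ Matrix.unitaryGroup o ℂ) (hdist : ∀ g, ‖ι g - 1‖ = dist1 g)
    (hL6 : 6 * (P.d + 2) ≤ P.L) (V : GaugeField P 0 (Matrix.specialUnitaryGroup n ℂ)) {α β : ℝ} (hβ : 0 ≤ β)
    (hsize : ∀ b : PBond P 0, (P.L : ℝ) ^ P.K * dist1 (V b) ≤ α)
    (hlip : ∀ (x : Site P 0) (ν μ : Fin P.d), (P.L : ℝ) ^ P.K * ‖ι (V ⟨x.shift μ, ν⟩) - ι (V ⟨x, ν⟩)‖ ≤ β / (P.L : ℝ) ^ P.K)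
    {j : ℕ} (hj : j ≤ P.K) (c : PBond P j) :
    dist1 (corrAcc (expMeanLogSU (n := n)) V j c)
      ≤ 2 * (3 * (((P.d : ℝ) / 2 + (P.d : ℝ) ^ 2 / 8) * (2 * β + 2 * α ^ 2))) / ((P.L : ℝ) ^ (P.K - j)) ^ 2 :=
  dist1_corrAcc_le_of_hκ _ (by omega) V (by positivity) (dist1_corr_avgTower_le ι hι hdist hL6 V hβ hsize hlip) hj c

/-- [folklore] **THE MODEL READING**: with `ι := fundamentalRep n` (the inclusion `SU(N) ↪ M_N(ℂ)`; `‖fundamentalRep n g − 1‖ = dist1 g` is the model's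
definition of `dist1`, `rfl`) the Lipschitz letter is stated on the matrices themselves and the END has no `ι`-binders. -/
theorem dist1_corr_avgTower_le_fundamentalRep (hL6 : 6 * (P.d + 2) ≤ P.L) (V : GaugeField P 0 (Matrix.specialUnitaryGroup n ℂ))
    {α β : ℝ} (hβ : 0 ≤ β)
    (hsize : ∀ b : PBond P 0, (P.L : ℝ) ^ P.K * dist1 (V b) ≤ α)
    (hlip : ∀ (x : Site P 0) (ν μ : Fin P.d),
      (P.L : ℝ) ^ P.K * ‖((V ⟨x.shift μ, ν⟩ : Matrix.specialUnitaryGroup n ℂ) : Matrix n n ℂ) - ((V ⟨x, ν⟩ : Matrix.specialUnitaryGroup n ℂ) : Matrix n n ℂ)‖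
        ≤ β / (P.L : ℝ) ^ P.K) :
    ∀ i < P.K, ∀ c : PBond P (i + 1),
      dist1 (corr (expMeanLogSU (n := n)) (avgTower (expMeanLogSU (n := n)) V i) c)
        ≤ 3 * (((P.d : ℝ) / 2 + (P.d : ℝ) ^ 2 / 8) * (2 * β + 2 * α ^ 2)) / ((P.L : ℝ) ^ (P.K - 1 - i)) ^ 2 :=
  dist1_corr_avgTower_le (fundamentalRep n) fundamentalRep_mem_unitaryGroup (fun _ => rfl) hL6 V hβ hsize
    (fun x ν μ => by simpa only [fundamentalRep_apply] using hlip x ν μ)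

end SU

end Summit.QuantumFields.BalabanUV.T4Continuum.B13AvgCorrKappa

end
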